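import Literature.MathematicalPhysics.QuantumFieldTheory.Balaban1983to89.B13Inv214PolarChain
import Literature.Analysis.Matrix.DetExp

/-!
# `Balaban1983to89.B13Inv214OrbitSUN` — [II] pp. 21–22, the orbit paragraph for print's SEMISIMPLE gauge group
# `G = SU(N) ⊂ U(N)`, `Gᶜ = SL(N, ℂ)` ([I] pp. 251–252, p. 259): constancy on (`SL(N, ℂ)`-orbit) ∩ (the `Gᶜ`-VALUED
# tube) from (26) for `SU(N)`-valued site-dependent transformations + holomorphy on the tube ALONE; the orbit notions
# of `…B13Inv214Orbit` RELATIVE TO A SUBGROUP `H ≤ 𝔸ˣ`; the sub-tube identity principle; 2 × 2 sharpness examples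

Paper sub-cell B13 of the Bałaban programme audit (cell `pub-balaban`), generation 22 (v1); a NEW LEAF over this
lineage's `…B13Inv214PolarChain` (v1.1, p189029) — whose HONEST SCOPE (d) reads *«`G`-valued := unitary-valued in `𝔸`
(a `U(N)`-type slice, not `SU(N)`; C-B13-45 I-3)»* — and over the b10 lineage's `…B10Eq26TubeIdentity` (v1, p188166) —
whose HONEST SCOPE (iii) reads *«The `G`-sub-tube version of `tubeIdentity` (…) is NOT typed here, because no joint
theorem of the lineage is posed on a sub-tube»*; both imported (the second through the first) and used BY NAME,
nothing restated, nothing edited; `Literature.Analysis.Matrix.DetExp` (Liouville's formula) by name.  VALUE = the one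
modelling gap that BOTH lineages flag at [II] pp. 21–22 is closed for the group print actually names.  Print's `G` is a
SEMISIMPLE compact `G ⊂ U(N)` ([I] p. 252, p. 259), so `U(N)` itself (the lineage's unitary slice `U(𝔸)`) is not an
instance, while `G = SU(N)`, `Gᶜ = SL(N, ℂ)`, `𝔤ᶜ = 𝔰𝔩(N, ℂ)` is.  For it: (a) the two printed sentences *«This means
that the expressions are constant on intersections of orbits with the corresponding space of configurations … We
extend them to constant functions on whole orbits having non-empty intersections with the space»* follow, on the
`Gᶜ`-VALUED tube (`SubTube` = bondwise `exp(B)·U`, `‖B‖ < a`, `tr B = 0`, `U ∈ SU(N)` — the shape of [I] (1.13) with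
(ii) *«A′ has values in the algebra 𝐠ᶜ»*), from (26) for the `SU(N)`-VALUED site-dependent transformations on the
`SU(N)`-valued configurations + holomorphy on the `a`-tube, with NO further input and for ALL `SL(N, ℂ)`-valued `g`
(`orbitConstOnIn_subTube_third`, `exists_slOrbitExtension_subTube_third`); (b) the `U(N)`-model's theorem
`B13Inv214PolarChain.orbitConstOn_tube_third` is NOT the `G = SU(N)` statement and does not imply it: its hypothesis
(26)\_{U(N)} FAILS for the (26)\_{SU}-invariant holomorphic bond determinant `det V_b`, and so does its conclusion
(`det V_b` is not constant on `GL(2, ℂ)`-orbits ∩ tube) (§6 (T1)); (c) the conclusion set must be the `Gᶜ`-valued tube,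
not the tube (§6 (T2)).  NOT summit progress; NO disputed step of the papers under audit is certified; HONEST SCOPE below.

CITATION HEADER (lean-in-tree rule 2026-08-18).  Sources (held; every quotation re-read this generation from the OCR
pages of the held scans, `paper:balaban1988-cmp116-rg-ii-cluster` `p0021/p0022`, `paper:balaban1987-cmp109-rg-i-
small-field` `p0003/p0004/p0011/p0014/p0035/p0036`, and for [I] p. 252 also from the render
`b2b-balaban-ref1/pages/1987-cmp109-rg-I-small-field/1987-cmp109-rg-I-small-field-p004-x2.png`):
* [Balaban1988RG2Cluster] = B13 = [II], T. Bałaban, *Renormalization group approach to lattice gauge field theories.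
  II. Cluster expansions*, Commun. Math. Phys. **116** (1988) 1–22, p. 21 last paragraph → p. 22, VERBATIM: *«Let us
  make a last remark about the expressions (2.14). By Lemma 2, and the transformation properties of the operators in
  (2.14) with respect to gauge transformations, e.g. see (3.28)–(3.34) [13], the expressions (2.14) are gauge invariant
  with respect to all G-valued transformations. The expressions are analytic functions of (U, J), hence the invariance
  can be extended, by the analyticity, to Gᶜ-valued gauge transformations in a small neighborhood of the space of
  G-valued ones. This means that the expressions are constant on intersections of orbits with the corresponding space
  of configurations (U, J) satisfying the conditions I.(i)–(iv). We extend them to constant functions on whole orbits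
  having non-empty intersections with the space.»*
* [Balaban1987RG1] = B12 = [I], T. Bałaban, *Renormalization group approach to lattice gauge field theories. I.*,
  Commun. Math. Phys. **109** (1987) 249–301.  pp. 251–252, VERBATIM: *«Field configurations have values in a compact
  Lie group G. … We assume that G is semisimple and that it is a Lie subgroup of a group of complex unitary matrices,
  for example G ⊂ U(N). (In fact a bigger part of our considerations does not depend on the semisimplicity
  assumption.)»*; p. 252: *«For technical reasons we wish to establish analyticity with respect to group valued gauge
  fields. Therefore we also consider the complexified group Gᶜ. Elements of this group are defined as matrices of the
  form 𝐔 = U′U, where U ∈ G and U′ = exp iA′, A′ ∈ 𝐠ᶜ, 𝐠ᶜ is the complexification of the real Lie algebra 𝐠.»*;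
  p. 259: *«It will be proved in this paper for an arbitrary semisimple compact Lie group G ⊂ U(N), and for d = 4.»*;
  p. 262 (1.13) (ii): *«U′ = exp iξA′, A′ has values in the algebra 𝐠ᶜ, |A′|, |∇_U^ξ A′| < α₁ on X»* (quoted in full
  with (i), (iii), (iv) in `…B13Inv214PolarChain` §0); p. 276 after (3.29) (the proviso that transformed
  configurations stay in proper spaces, b13's `hmaps`, quoted in `…B13Inv214Orbit`); p. 283, VERBATIM: *«We assume
  the gauge invariance with respect to Gᶜ-valued gauge transformations, but it is implied by the invariance with
  respect to G-valued transformations, and by the analyticity of the function, as it was noticed already.»*; p. 284: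
  *«The group G is semisimple, hence this is possible only for the element 0 in the algebra 𝐠ᶜ.»* (where print USES
  semisimplicity — not needed for anything in this file, recorded to show the assumption is live in [I]).
* [Balaban1985UV3] = B10, (26) p. 263 *«for all gauge transformations 𝓊»* — cited for the SHAPE (26) exactly as in
  `…B10Eq26SiteGauge` (quoted there from the render), through whose `SiteGaugeInv` / b13's `gaugeAct` it enters.

WHAT THE KERNEL PROVES (every `theorem` kernel-checked, no placeholders; `[folklore]` = standard mathematics stated and
proved here; `[cite: …]` = the docstring names the printed sentence the statement MODELS — never a hypothesis).
* §1 [folklore] THE ORBIT NOTIONS RELATIVE TO `H ≤ 𝔸ˣ` (generic unital C⋆-algebra `𝔸`, bond system `γ : Ends ι S`):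
  `OrbitConstOnIn γ H F 𝒮` / `NearOrbitConstOnIn γ H a F 𝒮` / `TubeReachIn` / `TubeChainConnectedIn` = the parent's
  (R3) / (R2) / chains with the transformations `g : S → 𝔸ˣ` restricted to be `H`-VALUED (`g x ∈ H`); `H = ⊤` recovers
  the parent's notions (`orbitConstOnIn_top_iff`, `nearOrbitConstOnIn_top_iff`), antitone in `(H, 𝒮)` (`.anti`), (R2) +
  chains ⇒ (R3) (`orbitConstOnIn_of_nearOrbitConstOnIn`), (R3) ⟺ an `H`-gauge-invariant extension exists
  (`orbitConstOnIn_iff_extends`, `B12Inv329.orbitExtension_iff` with `𝒢 = Hˢ`).  `PolarClosed H` (closed under the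
  polar path `t ↦ exp(t·polarLog u)·polarUnit u`), `PolarConvexIn γ H 𝒞` (the v1.1 notion asked for `H`-valued `g`
  only), and `tubeChainConnectedIn_of_polarConvexIn`: `H` polar-closed + `𝒞` polar-convex rel. `H` ⇒ `𝒞` is chain
  connected by `H`-valued tube-valued steps of every half-width `a > 0` (the v1.1 chain, whose steps are polar steps).
* §2 [folklore] `slUnits N = SL(N, ℂ) ≤ M_N(ℂ)ˣ` and DETERMINANT ONE ALONG THE POLAR DECOMPOSITION: `det u = 1` ⇒
  `tr(polarLog u) = 0` and `polarUnit u ∈ SU(N)` (`1 = e^{tr P}·det W`, `tr P` real, `|det W| = 1`; Liouville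
  `det_exp_eq_exp_trace` by name); hence `SL(N, ℂ)` is polar-closed (`polarClosed_slUnits`).
* §3 THE `Gᶜ`-VALUED TUBE `SubTube ι N a := TubeCfg ι (M_N ℂ) a ∩ {∀ b, det V_b = 1}`; `mem_subTube_iff`: bondwise
  `V_b = exp(B)·U`, `‖B‖ < a`, `tr B = 0`, `U ∈ SU(N)` [cite: (1.13) (ii)]; the polar normal form with `B` moreover
  self-adjoint (`exists_polar_of_mem_subTube`); `SL`-valued `g` preserve bond determinants, so `SubTube` is polar-convex
  rel. `SL(N, ℂ)` and chain connected by `SL`-valued steps of every half-width (`tubeChainConnectedIn_subTube`).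
* §4 [folklore] THE SUB-TUBE IDENTITY PRINCIPLE `eqOn_subTube_of_eqOn_specialUnitary`: holomorphic on the `a`-tube and
  equal on the `SU(N)`-VALUED configurations ⇒ equal on `SubTube ι N a` — b10's `tubeIdentity` argument run on the slice
  curve of the POLAR data (for self-adjoint traceless `B_b` the curve `t ↦ exp(−itB_b)·U_b` is `SU(N)`-valued at real
  `t`).  (b10 HONEST SCOPE (iii) suggested the `ℜ/ℑ` curve of a traceless `B`; on `SubTube` the membership data `B`
  need not be traceless bond by bond — only `e^{tr B}·det U = 1` — whence the polar normal form first.)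
* §5 THE PARAGRAPH FOR `G = SU(N)`.  `SiteGaugeInvSU γ F` := (26) for all `SU(N)`-valued site-dependent `u` on all
  `SU(N)`-valued configurations [cite: [II] p. 21, [I] (3.29), B10 (26)] — implied by b10's `U(N)`-form `SiteGaugeInv`
  and strictly weaker (§6).  `siteGaugeInvSU_subTube` (continuation in `𝐕`: invariance under `SU(N)`-valued `u` on the
  whole `Gᶜ`-valued tube); `slInvariant_subTube` (continuation in `u` *«to Gᶜ-valued gauge transformations in a small
  neighborhood»*: with margins `MapsTube (M_N ℂ) γ a a₀ c`, `F(𝐕ᵘ) = F(𝐕)` for `u` in the `SL`-valued `c`-tube, `𝐕` in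
  the `Gᶜ`-valued `a₀`-tube); `nearOrbitConstOnIn_subTube` (R2); **`orbitConstOnIn_subTube`** (R3): margins + holomorphy
  on the `a`-tube + (26)\_{SU} ⇒ `OrbitConstOnIn γ (slUnits N) F (SubTube ι N a₀)`; the binder-minimal
  **`orbitConstOnIn_subTube_third (ha : 0 < a) (hF : DifferentiableOn ℂ F (TubeCfg ι (M_N ℂ) a))
  (h26 : SiteGaugeInvSU γ F) : OrbitConstOnIn γ (slUnits N) F (SubTube ι N (a/3))`** (margins from v1.1's
  `mapsTube_third`), unfolded `apply_smul_eq_of_det_eq_one`, and (R4) `exists_slOrbitExtension_subTube_third` (an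
  extension to all configurations invariant under every `SL(N, ℂ)`-valued gauge transformation).  Comparison:
  `orbitConstOnIn_subTube_third_of_siteGaugeInv` (the `U(N)`-hypothesis gives the `SU(N)`-conclusion via v1.1 + `.anti`).
* §6 SHARPNESS, `N = 2`, one bond (`B13Inv214Orbit.toyEnds`), all [folklore]: `differentiable_det` (Leibniz);
  `siteGaugeInvSU_det` (the bond determinant satisfies (26)\_{SU} for every bond system and `N`); (T1)
  `not_siteGaugeInv_toyDet` (`u = (i·1, 1)`: (26)\_{U(N)} fails for it), `not_orbitConstOn_toyDet` (`g = (e^{s}·1, 1)`,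
  `0 < s < a/3`: NOT constant on `GL`-orbit ∩ `a/3`-tube), `orbitConstOnIn_toyDet` (§5 applies); (T2)
  `example_conclusion_needs_subTube`: `F = (det V_b − 1)·(V_b)₀₀` is holomorphic and (26)\_{SU}-invariant but NOT
  constant on `SL(2, ℂ)`-orbit ∩ TUBE (`𝐕 ≡ i·1 ∈ U(2)`, `g = (J, 1)`, `J = [[0,1],[−1,0]] ∈ SU(2)`: `0 ≠ −2i`); (T0)
  `example_subTube_strict`: `SU(2)`-valued ⊊ `SubTube` ⊊ tube (`e^{sH}`, `H = diag(1, −1)`, is in the sub-tube and not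
  unitary — by v1.1's rigidity `exp_mul_mul_exp_neg_eq_of_mem_unitary` and `CFC.log`; `i·1` is in the tube, `det = −1`).

THE DICTIONARY (model ↔ print; extends D-b13.30 of `…B13Inv214PolarChain` by the group).  `G` ↔ `SU(N) =
Matrix.specialUnitaryGroup (Fin N) ℂ` (print: any semisimple compact `G ⊂ U(N)`; here THE EXAMPLE `SU(N)`, no abstract
Lie subgroup is modelled); `Gᶜ` ↔ `SL(N, ℂ)`: as single-site values of transformations `slUnits N ≤ (M_N ℂ)ˣ`, as bond
values `det V_b = 1`; `𝐠ᶜ` ↔ traceless matrices (`tr B = 0`; `B = iA′`); [I] (1.13) tube clause with (ii) ↔ `SubTube ι N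
α₁` (`mem_subTube_iff`); (1.10) `u₋Uu₊⁻¹` ↔ `g • V` / `gaugeAct` (parent); *«G-valued transformations»* ↔ `u : S → M_N ℂ`
with `u x ∈ SU(N)`; *«orbits»* ↔ orbits of the group of `SL(N, ℂ)`-VALUED gauge transformations (`OrbitConstOnIn γ
(slUnits N)`); *«the corresponding space of configurations»* ↔ the `Gᶜ`-valued `a₀`-tube (tube clause only, see (b)).

HONEST SCOPE.  (a) As in the parent and v1.1: print gives no mechanism for *«by the analyticity»* / *«This means»*;
§4's identity principle and the `SL`-relative polar chain are [folklore] mathematics supplied by the audit; (26)\_{SU}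
and holomorphy on the tube are HYPOTHESES about print's never-constructed expressions (2.14) (G-adv7-7), never
discharged; nothing printed is used as a hypothesis.  (b) THE SPACE: only the TUBE CLAUSE of [I] p. 262 (ii) (with
(i) `U` `G`-valued) is modelled, now with its Lie-algebra constraint *«A′ has values in the algebra 𝐠ᶜ»*; NOT examined,
exactly as listed in v1.1 HONEST SCOPE (b) plus the item owed there (C-A61-1 D1): (i)-1 the plaquette clause
`|∂U − 1| < α₀ξ²` of (1.11) on the `G`-valued factor `U`, (i)-2 the cube-wise axial-gauge clause (1.12), (ii)-2
`|∇_U^ξ A′| < α₁`, (iii) (1.14) (of bi-covariant norm type — v1.1 §5 handles such clauses for `H = ⊤`; the `SL`-relative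
tools `PolarConvexIn.inter` + `polarConvexIn_of_polarConvex` are here, but no joint statement with (1.14) is posed),
(iv) (1.16).  (c) HOLOMORPHY is asked on the AMBIENT `a`-tube of `M_N(ℂ)^ι` (the lineage's standing domain, where
b10/b13's joint theorems live), which is MORE than print needs (analyticity on a `Gᶜ`-valued neighbourhood only); a
version with holomorphy only along `SL(N, ℂ)^ι` (a complex submanifold) is not typed — a modelling binder, recorded.
(d) `[Fintype ι]` for the identity principle, `[Fintype S]` for the chain; `N` arbitrary (`N = 0, 1` trivial); `a > 0`.
(e) No bound of the papers, no convergence, nothing on Lemma 2 / (2.14) themselves, Theorem I.3 or the continuum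
limit; not Clay-problem progress.

SIBLING PRIOR ART (by name, not restated): `B13Inv214Orbit` (action, `Cfg`, `OrbitConstOn`, `toyEnds`),
`B13Inv214PolarChain` (`polarLog/polarUnit/polarStep/polarPath`, `PolarConvex`, `polarConvex_tubeCfg`,
`coe_mem_tube_iff`, `mapsTube_third`, `orbitConstOn_tube_third`, rigidity), `B10Eq26TubeIdentity`
(`sliceGen/sliceCurve/sliceRegion`, `tubeIdentity`'s mechanism; its §5 `classFn_tube_of_suUnitary` is the OTHER `SU(N)`
reading — (26) for CONSTANT `SU(N)` transformations on `U(N)`-valued configurations — and its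
`example_su_slice_too_small` is the phenomenon (T2) builds on), `B10Eq26SiteGauge` (`SiteGaugeInv`, `MapsTube`,
`gaugeAct_mem_tubeCfg_of_unitary`, `differentiable_gaugeAct_cfg`), `B10Eq29TubeLine` (`Tube`, `TubeCfg`,
`cstarAlgebraMatrix`), `B7Prop1Explicit.expUnit`, `B7Prop2SpecialUnitary` (`specialUnitaryUnits`: `SU(N)` inside the
units — here `SL(N, ℂ)` inside the units, by `det`), `LogChartPolar` (`polarUnit_mem_specialUnitaryGroup` for the
`mlog`-chart polar data near `1`, `‖g − 1‖ ≤ 1/10` — here for ARBITRARY invertible `u` via the CFC `polarLog`),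
`B12Membership313IISL` (`det ∘ exp` bookkeeping on `i·𝔰𝔲`), `B12Inv329` (`orbitExtension_iff`),
`Literature.Analysis.Matrix.det_exp_eq_exp_trace`; Mathlib `Matrix.specialUnitaryGroup`, `Matrix.entryLinearMap`,
`CFC.log_exp`.  ABSOLUTE RULE: no statement of the manuscripts under audit and no programme-internal claim enters as a
hypothesis; all quotations carry page references.

RECORDS: cell GAPS C-B13-48 (this module); DIVERGENCE D-b13.31 (the dictionary's group line: the lineage's
`U(𝔸)`-slice vs print's semisimple `G ⊂ U(N)`; what changes and what does not); CENSUS-B13-v2 row «p. 21–22»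
addendum; no new bib key.
-/

open Set NormedSpace Filter
open scoped Topology ComplexStarModule

namespace Literature.MathematicalPhysics.QuantumFieldTheory.Balaban1983to89.B13Inv214OrbitSUN

open B10Eq29TubeLine (Tube TubeCfg mem_tube mem_tubeCfg mem_tubeCfg_of_unitary mem_tube_of_mem_unitary
  exp_mul_mem_tube cstarAlgebraMatrix)
open B10Eq26TubeIdentity (sliceGen sliceCurve sliceRegion sliceCurve_I sliceCurve_ofReal_mem_unitary
  convex_sliceRegion isOpen_sliceRegion zero_mem_sliceRegion I_mem_sliceRegion mapsTo_sliceCurve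
  differentiable_sliceCurve frequently_nhdsNE_zero_of_forall_ofReal)
open B10Eq26SiteGauge (MapsTube SiteGaugeInv tubeCfg_subset_of_mapsTube gaugeAct_mem_tubeCfg_of_unitary
  differentiable_gaugeAct_cfg)
open B7Prop1Explicit (expUnit val_expUnit)
open B13Inv214Orbit (Ends gaugeAct gaugeAct_eq_star Cfg OrbitConstOn NearOrbitConstOn isUnit_of_mem_unitary
  isUnit_of_mem_tube smul_eq_gaugeAct differentiableOn_gaugeAct)
open B13Inv214PolarChain (polarLog polarUnit isSelfAdjoint_polarLog polarUnit_mem_unitary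
  exp_polarLog_mul_polarUnit norm_polarLog_lt coe_mem_tube_iff polarUnitU polarStep val_polarStep
  val_polarStep_zero polarStep_add polarStep_one polarPath polarPath_one polarPath_add polarPath_zero_mem_tubeCfg
  expUnit_smul_polarLog_mem_tubeCfg PolarConvex polarConvex_tubeCfg mapsTube_third)
open Literature.Analysis.Matrix (det_exp_eq_exp_trace)

/-! ## §1. [folklore] The orbit notions of `B13Inv214Orbit` / `B13Inv214PolarChain` RELATIVE TO A SUBGROUP
## `H ≤ 𝔸ˣ` of admissible single-site values of the gauge transformations -/

section Relative

variable {ι S : Type*} {𝔸 : Type*} [CStarAlgebra 𝔸] (γ : Ends ι S) (H : Subgroup 𝔸ˣ)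

/-- (R3) RELATIVE TO `H`: `F` takes equal values at any two points of the space `𝒮` on one orbit of the group of
`H`-VALUED gauge transformations `g : S → 𝔸ˣ` (`g x ∈ H` for every site).  For `H = ⊤` this is
`B13Inv214Orbit.OrbitConstOn` (`orbitConstOnIn_top_iff`); for `𝔸 = M_N(ℂ)`, `H = SL(N, ℂ)` it is print's sentence for
`G = SU(N)`, `Gᶜ = SL(N, ℂ)`. [cite: Balaban1988RG2Cluster, p.22 («This means that the expressions are constant on
intersections of orbits with the corresponding space of configurations»); Balaban1987RG1, pp.251–252] -/
def OrbitConstOnIn (F : (ι → 𝔸) → ℂ) (𝒮 : Set (ι → 𝔸)) : Prop :=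
  ∀ (g : S → 𝔸ˣ) (V : Cfg γ 𝔸), (∀ x, g x ∈ H) → V ∈ 𝒮 → g • V ∈ 𝒮 → F (g • V) = F V

/-- (R2) RELATIVE TO `H`: constancy along the NEAR-`G` part of orbit ∩ space, for `H`-valued tube-valued steps.
[cite: Balaban1988RG2Cluster, pp.21–22] -/
def NearOrbitConstOnIn (a : ℝ) (F : (ι → 𝔸) → ℂ) (𝒮 : Set (ι → 𝔸)) : Prop :=
  ∀ (h : S → 𝔸ˣ) (V : Cfg γ 𝔸), (∀ x, h x ∈ H) → (fun x => (h x : 𝔸)) ∈ TubeCfg S 𝔸 a → V ∈ 𝒮 →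
    h • V ∈ 𝒮 → F (h • V) = F V

/-- Reachability inside the space by `H`-valued tube-valued steps. [folklore] -/
inductive TubeReachIn (a : ℝ) (𝒮 : Set (ι → 𝔸)) : Cfg γ 𝔸 → Cfg γ 𝔸 → Prop
  /-- the empty chain at a point of the space -/
  | refl (V : Cfg γ 𝔸) : V ∈ 𝒮 → TubeReachIn a 𝒮 V V
  /-- one more `H`-valued tube-valued step, landing in the space -/
  | step (V W : Cfg γ 𝔸) (h : S → 𝔸ˣ) : TubeReachIn a 𝒮 V W → (∀ x, h x ∈ H) →
      (fun x => (h x : 𝔸)) ∈ TubeCfg S 𝔸 a → h • W ∈ 𝒮 → TubeReachIn a 𝒮 V (h • W)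

/-- Tube-chain-connectedness of (`H`-orbit) ∩ space by `H`-valued steps. [folklore] -/
def TubeChainConnectedIn (a : ℝ) (𝒮 : Set (ι → 𝔸)) : Prop :=
  ∀ (g : S → 𝔸ˣ) (V : Cfg γ 𝔸), (∀ x, g x ∈ H) → V ∈ 𝒮 → g • V ∈ 𝒮 → TubeReachIn γ H a 𝒮 V (g • V)

variable {γ H}

/-- A reachable configuration lies in the space. [folklore] -/
theorem TubeReachIn.mem {a : ℝ} {𝒮 : Set (ι → 𝔸)} {V W : Cfg γ 𝔸} (hVW : TubeReachIn γ H a 𝒮 V W) : W ∈ 𝒮 := by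
  cases hVW with
  | refl hV => exact hV
  | step _ _ _ _ _ hW => exact hW

/-- Near-orbit constancy propagates along chains inside the space. [folklore] -/
theorem TubeReachIn.apply_eq {a : ℝ} {F : (ι → 𝔸) → ℂ} {𝒮 : Set (ι → 𝔸)} (hF : NearOrbitConstOnIn γ H a F 𝒮)
    {V W : Cfg γ 𝔸} (hVW : TubeReachIn γ H a 𝒮 V W) : F W = F V := by
  induction hVW with
  | refl _ => rfl
  | step W h hW hh htube hmem ih => exact (hF h W hh htube hW.mem hmem).trans ih

variable (γ H)

/-- (R3) FROM (R2), relative to `H`. [cite: Balaban1988RG2Cluster, p.22] -/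
theorem orbitConstOnIn_of_nearOrbitConstOnIn {a : ℝ} {F : (ι → 𝔸) → ℂ} {𝒮 : Set (ι → 𝔸)}
    (hF : NearOrbitConstOnIn γ H a F 𝒮) (hconn : TubeChainConnectedIn γ H a 𝒮) : OrbitConstOnIn γ H F 𝒮 :=
  fun g V hg hV hgV => (hconn g V hg hV hgV).apply_eq hF

/-- The absolute notion implies the relative one for every `H`. [folklore] -/
theorem orbitConstOnIn_of_orbitConstOn {F : (ι → 𝔸) → ℂ} {𝒮 : Set (ι → 𝔸)} (h : OrbitConstOn γ F 𝒮) :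
    OrbitConstOnIn γ H F 𝒮 :=
  fun g V _ hV hgV => h g V hV hgV

/-- `H = ⊤` (all of `𝔸ˣ`, the `U(𝔸)`-model's `Gᶜ`) recovers `B13Inv214Orbit.OrbitConstOn`. [folklore] -/
theorem orbitConstOnIn_top_iff {F : (ι → 𝔸) → ℂ} {𝒮 : Set (ι → 𝔸)} :
    OrbitConstOnIn γ ⊤ F 𝒮 ↔ OrbitConstOn γ F 𝒮 :=
  ⟨fun h g V hV hgV => h g V (fun _ => Subgroup.mem_top _) hV hgV, orbitConstOnIn_of_orbitConstOn γ ⊤⟩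

/-- `H = ⊤` recovers `B13Inv214Orbit.NearOrbitConstOn`. [folklore] -/
theorem nearOrbitConstOnIn_top_iff {a : ℝ} {F : (ι → 𝔸) → ℂ} {𝒮 : Set (ι → 𝔸)} :
    NearOrbitConstOnIn γ ⊤ a F 𝒮 ↔ NearOrbitConstOn γ a F 𝒮 :=
  ⟨fun h g V htube hV hgV => h g V (fun _ => Subgroup.mem_top _) htube hV hgV,
    fun h g V _ htube hV hgV => h g V htube hV hgV⟩

variable {γ H} in
/-- Antitonicity in the subgroup and in the space. [folklore] -/
theorem OrbitConstOnIn.anti {H₁ H₂ : Subgroup 𝔸ˣ} {F : (ι → 𝔸) → ℂ} {𝒮₁ 𝒮₂ : Set (ι → 𝔸)} (hH : H₁ ≤ H₂)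
    (h𝒮 : 𝒮₁ ⊆ 𝒮₂) (h : OrbitConstOnIn γ H₂ F 𝒮₂) : OrbitConstOnIn γ H₁ F 𝒮₁ :=
  fun g V hg hV hgV => h g V (fun x => hH (hg x)) (h𝒮 hV) (h𝒮 hgV)

/-- **(R4) relative to `H`** ([II] p. 22 *«We extend them to constant functions on whole orbits having non-empty
intersections with the space»*): (R3) relative to `H` is EXACTLY the well-definedness of the extension to a function of
all configurations invariant under the `H`-valued gauge transformations — the sibling `B12Inv329.orbitExtension_iff`
for the subgroup `{g | ∀ x, g x ∈ H}` (`Subgroup.pi univ`). [cite: Balaban1988RG2Cluster, p.22] -/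
theorem orbitConstOnIn_iff_extends (F : (ι → 𝔸) → ℂ) (𝒮 : Set (ι → 𝔸)) :
    OrbitConstOnIn γ H F 𝒮 ↔
      ∃ Fext : Cfg γ 𝔸 → ℂ, (∀ (g : S → 𝔸ˣ) (V : Cfg γ 𝔸), (∀ x, g x ∈ H) → Fext (g • V) = Fext V) ∧
        ∀ V ∈ 𝒮, Fext V = F V := by
  classical
  let K : Subgroup (S → 𝔸ˣ) := Subgroup.pi Set.univ fun _ => H
  have hK : ∀ {g : S → 𝔸ˣ}, g ∈ K ↔ ∀ x, g x ∈ H := fun {g} => by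
    simp only [K, Subgroup.mem_pi, Set.mem_univ, true_implies]
  have h12 := B12Inv329.orbitExtension_iff (𝒢 := K) (X := Cfg γ 𝔸) 𝒮 F
  constructor
  · intro h
    obtain ⟨Fext, h1, h2⟩ := h12.2 fun g V hV hgV => h (g : S → 𝔸ˣ) V (hK.1 g.2) hV hgV
    exact ⟨Fext, fun g V hg => h1 ⟨g, hK.2 hg⟩ V, h2⟩
  · rintro ⟨Fext, h1, h2⟩ g V hg hV hgV
    rw [← h2 _ hgV, ← h2 _ hV]
    exact h1 g V hg

/-- POLAR-CLOSED subgroups: `H` contains, with `u`, its whole polar path `t ↦ exp(t·polarLog u)·polarUnit u`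
(`B13Inv214PolarChain.polarStep`), `t ∈ ℝ` — e.g. `⊤`, and `SL(N, ℂ) ≤ GL(N, ℂ)` (§2). [folklore] -/
def PolarClosed (H : Subgroup 𝔸ˣ) : Prop := ∀ ⦃u : 𝔸ˣ⦄, u ∈ H → ∀ t : ℝ, polarStep u t ∈ H

/-- `⊤` is polar-closed. [folklore] -/
theorem polarClosed_top : PolarClosed (⊤ : Subgroup 𝔸ˣ) := fun _ _ _ => Subgroup.mem_top _

/-- `polarStep u 0` is the unitary part, as units. [folklore] -/
theorem polarStep_zero_eq_polarUnitU (u : 𝔸ˣ) : polarStep u 0 = polarUnitU u :=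
  Units.ext (val_polarStep_zero u)

/-- The axial factor through the path: `exp(s·polarLog u) = polarStep u s · (polarStep u 0)⁻¹`. [folklore] -/
theorem expUnit_smul_polarLog_eq (u : 𝔸ˣ) (s : ℝ) :
    expUnit ((s : ℂ) • polarLog u) = polarStep u s * (polarStep u 0)⁻¹ := by
  rw [polarStep_zero_eq_polarUnitU, polarStep, mul_inv_cancel_right]

variable {H} in
/-- A polar-closed subgroup contains the axial factors `exp(s·polarLog u)` of its elements. [folklore] -/
theorem PolarClosed.expUnit_smul_polarLog_mem (hH : PolarClosed H) {u : 𝔸ˣ} (hu : u ∈ H) (s : ℝ) :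
    expUnit ((s : ℂ) • polarLog u) ∈ H := by
  rw [expUnit_smul_polarLog_eq]
  exact H.mul_mem (hH hu s) (H.inv_mem (hH hu 0))

/-- POLAR-CONVEXITY RELATIVE TO `H`: the polar path between `V` and `g • V` stays in `𝒞` whenever both ends do and
`g` is `H`-valued (`B13Inv214PolarChain.PolarConvex` asks it for every `g`). [folklore] -/
def PolarConvexIn (𝒞 : Set (ι → 𝔸)) : Prop :=
  ∀ (g : S → 𝔸ˣ) (V : Cfg γ 𝔸), (∀ x, g x ∈ H) → V ∈ 𝒞 → g • V ∈ 𝒞 →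
    ∀ t : ℝ, 0 ≤ t → t ≤ 1 → polarPath g t • V ∈ 𝒞

variable {γ H} in
/-- Absolute polar-convexity implies the relative one. [folklore] -/
theorem polarConvexIn_of_polarConvex {𝒞 : Set (ι → 𝔸)} (h : PolarConvex γ 𝒞) : PolarConvexIn γ H 𝒞 :=
  fun g V _ hV hgV t ht0 ht1 => h g V hV hgV t ht0 ht1

variable {γ H} in
/-- Intersections of relatively polar-convex sets are relatively polar-convex. [folklore] -/
theorem PolarConvexIn.inter {𝒞₁ 𝒞₂ : Set (ι → 𝔸)} (h₁ : PolarConvexIn γ H 𝒞₁) (h₂ : PolarConvexIn γ H 𝒞₂) :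
    PolarConvexIn γ H (𝒞₁ ∩ 𝒞₂) :=
  fun g V hg hV hgV t ht0 ht1 => ⟨h₁ g V hg hV.1 hgV.1 t ht0 ht1, h₂ g V hg hV.2 hgV.2 t ht0 ht1⟩

/-- **THE POLAR CHAIN RELATIVE TO A POLAR-CLOSED `H`** (`B13Inv214PolarChain.tubeChainConnected_of_polarConvex` with the
side conditions recorded): for `H`-valued `g` the unitary start `polarPath g 0` and the axial steps
`exp(polarLog(g x)/N)` are `H`-valued (`PolarClosed`), tube-valued, and the intermediate configurations stay in `𝒞`
(`PolarConvexIn`). [folklore] -/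
theorem tubeChainConnectedIn_of_polarConvexIn [Fintype S] {a : ℝ} (ha : 0 < a) (hH : PolarClosed H)
    {𝒞 : Set (ι → 𝔸)} (h𝒞 : PolarConvexIn γ H 𝒞) : TubeChainConnectedIn γ H a 𝒞 := by
  intro g V hg hV hgV
  set M : ℝ := ∑ x, ‖polarLog (g x)‖ with hM
  have hMx : ∀ x, ‖polarLog (g x)‖ ≤ M := fun x =>
    Finset.single_le_sum (f := fun x => ‖polarLog (g x)‖) (fun _ _ => norm_nonneg _) (Finset.mem_univ x)
  have hM0 : 0 ≤ M := Finset.sum_nonneg fun _ _ => norm_nonneg _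
  set N : ℕ := ⌊M / a⌋₊ + 1 with hN
  have hN0 : (0 : ℝ) < N := by positivity
  have hNa : M < N * a := by
    have := Nat.lt_floor_add_one (M / a)
    rw [hN, Nat.cast_add, Nat.cast_one]
    rwa [div_lt_iff₀ ha] at this
  have hstep : (fun x => (expUnit (((1 / (N : ℝ) : ℝ) : ℂ) • polarLog (g x)) : 𝔸)) ∈ TubeCfg S 𝔸 a := by
    refine expUnit_smul_polarLog_mem_tubeCfg g fun x => ?_
    rw [abs_of_pos (by positivity), one_div, inv_mul_lt_iff₀ hN0]
    exact (hMx x).trans_lt hNa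
  have hstepH : ∀ x, expUnit (((1 / (N : ℝ) : ℝ) : ℂ) • polarLog (g x)) ∈ H := fun x =>
    hH.expUnit_smul_polarLog_mem (hg x) _
  have hpathH : ∀ (t : ℝ) (x : S), polarPath g t x ∈ H := fun t x => hH (hg x) t
  have hchain : ∀ j : ℕ, j ≤ N → TubeReachIn γ H a 𝒞 V (polarPath g ((j : ℝ) / N) • V) := by
    intro j
    induction j with
    | zero =>
      intro _
      rw [Nat.cast_zero, zero_div]
      exact TubeReachIn.step V V (polarPath g 0) (TubeReachIn.refl V hV) (hpathH 0)
        (polarPath_zero_mem_tubeCfg g ha) (h𝒞 g V hg hV hgV 0 le_rfl zero_le_one)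
    | succ j ih =>
      intro hj
      have hj' : j ≤ N := Nat.le_of_succ_le hj
      have hsplit : ((j + 1 : ℕ) : ℝ) / N = 1 / N + (j : ℝ) / N := by
        rw [Nat.cast_add, Nat.cast_one]; ring
      have ht1 : ((j + 1 : ℕ) : ℝ) / N ≤ 1 := by
        rw [div_le_one hN0]; exact_mod_cast hj
      have hmem := h𝒞 g V hg hV hgV (((j + 1 : ℕ) : ℝ) / N) (by positivity) ht1
      rw [hsplit] at hmem ⊢
      rw [polarPath_add, mul_smul] at hmem ⊢
      exact TubeReachIn.step V _ _ (ih hj') hstepH hstep hmem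
  have hend := hchain N le_rfl
  rwa [div_self hN0.ne', polarPath_one] at hend

end Relative

/-! ## §2. [folklore] `SL(N, ℂ) ≤ GL(N, ℂ)`: determinant one along the polar decomposition -/

section SpecialLinear

/-- `M_N(ℂ)`. -/
local notation "M[" N "]" => Matrix (Fin N) (Fin N) ℂ

attribute [local instance] B10Eq29TubeLine.cstarAlgebraMatrix

variable {N : ℕ}

variable (N) in
/-- `SL(N, ℂ)` as a subgroup of the units `GL(N, ℂ) = M_N(ℂ)ˣ`: print's `Gᶜ` for `G = SU(N)` ([I] p. 252 «the
complexified group Gᶜ. Elements of this group are defined as matrices of the form 𝐔 = U′U, where U ∈ G and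
U′ = exp iA′, A′ ∈ 𝐠ᶜ»; `𝔤ᶜ = 𝔰𝔩(N, ℂ)`, `det(exp iA′ · U) = e^{i tr A′}·1 = 1`). [cite: Balaban1987RG1, pp.251–252] -/
def slUnits : Subgroup (M[N])ˣ where
  carrier := {g | Matrix.det (g : M[N]) = 1}
  mul_mem' := by
    intro g h hg hh
    simp only [Set.mem_setOf_eq, Units.val_mul, Matrix.det_mul] at *
    rw [hg, hh, mul_one]
  one_mem' := by simp only [Set.mem_setOf_eq, Units.val_one, Matrix.det_one]
  inv_mem' := by
    intro g hg
    simp only [Set.mem_setOf_eq] at *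
    have h := congrArg Matrix.det g.mul_inv
    rw [Matrix.det_mul, hg, one_mul, Matrix.det_one] at h
    exact h

/-- Membership in `slUnits N` is `det = 1`. [folklore] -/
@[simp] theorem mem_slUnits_iff {g : (M[N])ˣ} : g ∈ slUnits N ↔ Matrix.det (g : M[N]) = 1 := Iff.rfl

/-- Liouville's formula `det e^X = e^{tr X}` (tree: `Literature.Analysis.Matrix.det_exp_eq_exp_trace`), read under the
lineage's C⋆-structure `cstarAlgebraMatrix N`. [folklore] -/
theorem det_exp (X : M[N]) : (exp X).det = Complex.exp X.trace := by
  rw [Complex.exp_eq_exp_ℂ]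
  exact det_exp_eq_exp_trace X

/-- `|det W| = 1` for unitary `W`. [folklore] -/
theorem norm_det_of_mem_unitary {W : M[N]} (hW : W ∈ unitary (M[N])) : ‖W.det‖ = 1 :=
  CStarRing.norm_of_mem_unitary (Matrix.det_of_mem_unitary hW)

/-- The trace of a self-adjoint matrix is real. [folklore] -/
theorem im_trace_of_isSelfAdjoint {P : M[N]} (hP : IsSelfAdjoint P) : P.trace.im = 0 := by
  have h := Matrix.trace_conjTranspose P
  rw [← Matrix.star_eq_conjTranspose, hP.star_eq] at h
  exact Complex.conj_eq_iff_im.1 h.symm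

/-- **DETERMINANT ONE SPLITS ALONG THE POLAR DECOMPOSITION**: for an invertible `u` with `det u = 1`, the self-adjoint
logarithm `polarLog u` (`u = exp(polarLog u)·polarUnit u`, `B13Inv214PolarChain`) is TRACELESS and the unitary part has
determinant one — `1 = det u = e^{tr P}·det W` with `tr P` real and `|det W| = 1`. [folklore] -/
theorem trace_polarLog_and_det_polarUnit {u : (M[N])ˣ} (hu : Matrix.det (u : M[N]) = 1) :
    (polarLog u).trace = 0 ∧ (polarUnit u).det = 1 := by
  have hdet : Complex.exp (polarLog u).trace * (polarUnit u).det = 1 := by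
    rw [← det_exp, ← Matrix.det_mul, exp_polarLog_mul_polarUnit, hu]
  have him : (polarLog u).trace.im = 0 := im_trace_of_isSelfAdjoint (isSelfAdjoint_polarLog u)
  have hW : ‖(polarUnit u).det‖ = 1 := norm_det_of_mem_unitary (polarUnit_mem_unitary u)
  have hre : (polarLog u).trace.re = 0 := by
    have h := congrArg norm hdet
    rw [norm_mul, hW, mul_one, norm_one, Complex.norm_exp, Real.exp_eq_one_iff] at h
    exact h
  have htr : (polarLog u).trace = 0 := Complex.ext (by simpa using hre) (by simpa using him)
  refine ⟨htr, ?_⟩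
  rwa [htr, Complex.exp_zero, one_mul] at hdet

/-- Hence the unitary part of an `SL(N, ℂ)` element is in `SU(N)`. [folklore] -/
theorem polarUnit_mem_specialUnitaryGroup {u : (M[N])ˣ} (hu : Matrix.det (u : M[N]) = 1) :
    polarUnit u ∈ Matrix.specialUnitaryGroup (Fin N) ℂ :=
  Matrix.mem_specialUnitaryGroup_iff.2 ⟨polarUnit_mem_unitary u, (trace_polarLog_and_det_polarUnit hu).2⟩

/-- `det e^{zP} = 1` for traceless `P`. [folklore] -/
theorem det_exp_smul_of_trace_eq_zero {P : M[N]} (hP : P.trace = 0) (z : ℂ) : (exp (z • P)).det = 1 := by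
  rw [det_exp, Matrix.trace_smul, hP, smul_zero, Complex.exp_zero]

/-- The polar path of an `SL(N, ℂ)` element stays in `SL(N, ℂ)`. [folklore] -/
theorem polarStep_mem_slUnits {u : (M[N])ˣ} (hu : u ∈ slUnits N) (t : ℝ) : polarStep u t ∈ slUnits N := by
  rw [mem_slUnits_iff] at hu ⊢
  rw [val_polarStep, Matrix.det_mul, det_exp_smul_of_trace_eq_zero (trace_polarLog_and_det_polarUnit hu).1,
    (trace_polarLog_and_det_polarUnit hu).2, one_mul]

variable (N) in
/-- `SL(N, ℂ)` is polar-closed. [folklore] -/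
theorem polarClosed_slUnits : PolarClosed (slUnits N) := fun _ hu t => polarStep_mem_slUnits hu t

end SpecialLinear

/-! ## §3. The `Gᶜ`-VALUED TUBE (`G = SU(N)`, `Gᶜ = SL(N, ℂ)`): `SubTube ι N a = TubeCfg ∩ {det V_b = 1}` is
## bondwise `{exp(B)·U : ‖B‖ < a, tr B = 0, U ∈ SU(N)}` = print's (1.13)-configurations, and is polar-convex
## relative to `SL(N, ℂ)` -/

section SubTube

/-- `M_N(ℂ)`. -/
local notation "M[" N "]" => Matrix (Fin N) (Fin N) ℂ

attribute [local instance] B10Eq29TubeLine.cstarAlgebraMatrix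

variable {ι S : Type*} {N : ℕ}

variable (ι N) in
/-- THE `Gᶜ`-VALUED TUBE for `G = SU(N)`: the configurations of the lineage's `a`-tube (`V_b = exp(B)·U`, `‖B‖ < a`,
`U ∈ U(N)`) whose bond variables have DETERMINANT ONE — i.e. are `Gᶜ = SL(N, ℂ)`-valued; equivalently (`mem_subTube_iff`)
bondwise `V_b = exp(B)·U` with `‖B‖ < a`, `tr B = 0` (`B = iA′`, `A′ ∈ 𝔤ᶜ = 𝔰𝔩(N, ℂ)`) and `U ∈ SU(N) = G`: the shape
of [I] (1.13) «U′ = exp iξA′, |A′| < α₁» with (ii) «A′ has values in the algebra 𝐠ᶜ», around the `G`-valued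
configurations, for the semisimple `G = SU(N)` of [I] pp. 251–252.
[cite: Balaban1987RG1, (1.13) p.262, pp.251–252; Balaban1988RG2Cluster, p.21] -/
def SubTube (a : ℝ) : Set (ι → M[N]) := {V | V ∈ TubeCfg ι (M[N]) a ∧ ∀ b, (V b).det = 1}

/-- Unfolding. [folklore] -/
theorem mem_subTube {a : ℝ} {V : ι → M[N]} : V ∈ SubTube ι N a ↔ V ∈ TubeCfg ι (M[N]) a ∧ ∀ b, (V b).det = 1 :=
  Iff.rfl

/-- The `Gᶜ`-valued tube sits in the tube. [folklore] -/
theorem subTube_subset_tubeCfg (a : ℝ) : SubTube ι N a ⊆ TubeCfg ι (M[N]) a := fun _ hV => hV.1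

/-- Monotonicity in the half-width, through the tube's. [folklore] -/
theorem subTube_mono {a a' : ℝ} (h : TubeCfg ι (M[N]) a ⊆ TubeCfg ι (M[N]) a') : SubTube ι N a ⊆ SubTube ι N a' :=
  fun _ hV => ⟨h hV.1, hV.2⟩

/-- `SU(N)`-valued (`G`-valued) configurations lie in every `Gᶜ`-valued tube of positive half-width. [folklore] -/
theorem mem_subTube_of_specialUnitary {a : ℝ} (ha : 0 < a) {V : ι → M[N]}
    (hV : ∀ b, V b ∈ Matrix.specialUnitaryGroup (Fin N) ℂ) : V ∈ SubTube ι N a :=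
  ⟨mem_tubeCfg_of_unitary ha fun b => (Matrix.mem_specialUnitaryGroup_iff.1 (hV b)).1,
    fun b => (Matrix.mem_specialUnitaryGroup_iff.1 (hV b)).2⟩

/-- THE POLAR NORMAL FORM of a point of the `Gᶜ`-valued tube: bondwise `V_b = exp(B)·U` with `‖B‖ < a`, `B`
SELF-ADJOINT and TRACELESS, `U ∈ SU(N)` (`B := polarLog`, `U := polarUnit` of `V_b`; §2 and
`B13Inv214PolarChain.coe_mem_tube_iff`/`norm_polarLog_lt`). [folklore] -/
theorem exists_polar_of_mem_subTube {a : ℝ} {V : ι → M[N]} (hV : V ∈ SubTube ι N a) (b : ι) :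
    ∃ B U : M[N], ‖B‖ < a ∧ IsSelfAdjoint B ∧ B.trace = 0 ∧ U ∈ Matrix.specialUnitaryGroup (Fin N) ℂ ∧
      V b = exp B * U := by
  have hT : V b ∈ Tube (M[N]) a := mem_tubeCfg.1 hV.1 b
  have ha : 0 < a := by
    obtain ⟨B, -, hB, -, -⟩ := mem_tube.1 hT
    exact (norm_nonneg B).trans_lt hB
  obtain ⟨u, hu⟩ := isUnit_of_mem_tube hT
  have hT' := (coe_mem_tube_iff ha u).1 (hu ▸ hT)
  have hdet : Matrix.det (u : M[N]) = 1 := by rw [hu]; exact hV.2 b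
  exact ⟨polarLog u, polarUnit u, norm_polarLog_lt ha u hT'.1 hT'.2, isSelfAdjoint_polarLog u,
    (trace_polarLog_and_det_polarUnit hdet).1, polarUnit_mem_specialUnitaryGroup hdet,
    by rw [exp_polarLog_mul_polarUnit, hu]⟩

/-- **`SubTube` IS PRINT'S SET OF (1.13)-CONFIGURATIONS FOR `G = SU(N)`**: bondwise `V_b = exp(B)·U` with `‖B‖ < a`,
`B` TRACELESS (`B = iA′`, `A′ ∈ 𝔤ᶜ = 𝔰𝔩(N, ℂ)` arbitrary complex traceless) and `U ∈ SU(N) = G` (⇐: `det = e^{tr B}·det U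
= 1`; ⇒: the polar normal form). [cite: Balaban1987RG1, (1.13) p.262 («U′ = exp iξA′, |A′| < α₁», (ii) «A′ has values in
the algebra 𝐠ᶜ»), p.252 («𝐔 = U′U, where U ∈ G and U′ = exp iA′, A′ ∈ 𝐠ᶜ»)] -/
theorem mem_subTube_iff {a : ℝ} {V : ι → M[N]} :
    V ∈ SubTube ι N a ↔ ∀ b, ∃ B U : M[N], ‖B‖ < a ∧ B.trace = 0 ∧ U ∈ Matrix.specialUnitaryGroup (Fin N) ℂ ∧
      V b = exp B * U := by
  constructor
  · intro hV b
    obtain ⟨B, U, hB, -, htr, hU, hVb⟩ := exists_polar_of_mem_subTube hV b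
    exact ⟨B, U, hB, htr, hU, hVb⟩
  · intro h
    refine ⟨mem_tubeCfg.2 fun b => ?_, fun b => ?_⟩
    · obtain ⟨B, U, hB, -, hU, hVb⟩ := h b
      rw [hVb]
      exact exp_mul_mem_tube hB (Matrix.mem_specialUnitaryGroup_iff.1 hU).1
    · obtain ⟨B, U, -, htr, hU, hVb⟩ := h b
      rw [hVb, Matrix.det_mul, det_exp, htr, Complex.exp_zero, one_mul]
      exact (Matrix.mem_specialUnitaryGroup_iff.1 hU).2

variable (γ : Ends ι S)

/-- Determinants along the action: `det (g • V)_b = det g(b₋) · det V_b · det g(b₊)⁻¹`. [folklore] -/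
theorem det_smul_apply (g : S → (M[N])ˣ) (V : Cfg γ (M[N])) (b : ι) :
    ((g • V) b).det =
      Matrix.det (g (γ.src b) : M[N]) * (V b).det * Matrix.det (((g (γ.tgt b))⁻¹ : (M[N])ˣ) : M[N]) := by
  rw [B13Inv214PolarChain.smul_apply, Matrix.det_mul, Matrix.det_mul]

/-- `SL(N, ℂ)`-valued transformations preserve the bond determinants. [folklore] -/
theorem det_smul_apply_of_slUnits {g : S → (M[N])ˣ} (hg : ∀ x, g x ∈ slUnits N) (V : Cfg γ (M[N])) (b : ι) :
    ((g • V) b).det = (V b).det := by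
  rw [det_smul_apply, mem_slUnits_iff.1 (hg _), mem_slUnits_iff.1 ((slUnits N).inv_mem (hg _)), one_mul, mul_one]

/-- `{det V_b = 1 ∀ b}` is invariant under `SL(N, ℂ)`-valued transformations. [folklore] -/
theorem det_eq_one_smul_of_slUnits {g : S → (M[N])ˣ} (hg : ∀ x, g x ∈ slUnits N) {V : Cfg γ (M[N])}
    (hV : ∀ b, (V b).det = 1) (b : ι) : ((g • V) b).det = 1 := by
  rw [det_smul_apply_of_slUnits γ hg]; exact hV b

/-- **The `Gᶜ`-valued tube is polar-convex relative to `SL(N, ℂ)`**: the tube is polar-convex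
(`B13Inv214PolarChain.polarConvex_tubeCfg`) and the polar path of an `SL`-valued `g` is `SL`-valued (§2), so it keeps
`det V_b = 1`. [folklore] -/
theorem polarConvexIn_subTube (a : ℝ) : PolarConvexIn γ (slUnits N) (SubTube ι N a) := by
  intro g V hg hV hgV t ht0 ht1
  exact ⟨polarConvex_tubeCfg (γ := γ) a g V hV.1 hgV.1 t ht0 ht1,
    det_eq_one_smul_of_slUnits γ (fun x => polarStep_mem_slUnits (hg x) t) hV.2⟩

/-- Hence (`SL(N, ℂ)`-orbit) ∩ (`Gᶜ`-valued tube) is tube-chain-connected by `SL`-valued steps of any half-width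
`c > 0`. [folklore] — the discrete connectedness behind [II] p. 22 «This means», for `G = SU(N)`. -/
theorem tubeChainConnectedIn_subTube [Fintype S] {c : ℝ} (hc : 0 < c) (a : ℝ) :
    TubeChainConnectedIn γ (slUnits N) c (SubTube ι N a) :=
  tubeChainConnectedIn_of_polarConvexIn γ _ hc (polarClosed_slUnits N) (polarConvexIn_subTube γ a)

end SubTube

/-! ## §4. [folklore] THE IDENTITY PRINCIPLE ALONG THE `SU(N)`-SLICE OF THE `Gᶜ`-VALUED TUBE -/

section Identity

/-- `M_N(ℂ)`. -/
local notation "M[" N "]" => Matrix (Fin N) (Fin N) ℂ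

attribute [local instance] B10Eq29TubeLine.cstarAlgebraMatrix

variable {ι : Type*} [Fintype ι] {N : ℕ}

/-- For self-adjoint `P` the slice line is `sliceGen P t = −(i t)·P` (`ℜP = P`, `ℑP = 0`). [folklore] -/
theorem sliceGen_of_isSelfAdjoint {𝔸 : Type*} [CStarAlgebra 𝔸] {P : 𝔸} (hP : IsSelfAdjoint P) (t : ℂ) :
    sliceGen P t = (-(Complex.I * t)) • P := by
  rw [sliceGen, hP.imaginaryPart, hP.coe_realPart, ZeroMemClass.coe_zero, zero_sub, smul_neg, smul_smul, neg_smul]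

/-- **THE SUB-TUBE IDENTITY PRINCIPLE.**  Two functions holomorphic on the bondwise `a`-tube of `M_N(ℂ)^ι` which agree
on the `SU(N)`-VALUED configurations agree on the `Gᶜ = SL(N, ℂ)`-valued tube `SubTube ι N a` — NOT on the whole
tube (`B10Eq26TubeIdentity.example_su_slice_too_small`: `det V_b` vs `1`).  Proof = `B10Eq26TubeIdentity.tubeIdentity`
verbatim with the bond data chosen as the POLAR data `B_b := polarLog`, `U_b := polarUnit` of `V_b` (§2: `tr B_b = 0`,
`U_b ∈ SU(N)`): then the slice curve `t ↦ (exp(−itB_b)·U_b)_b` is `SU(N)`-valued at real `t`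
(`det = e^{−it·tr B_b}·det U_b = 1`), and the one-variable identity theorem on the slice region applies as there.
This is the located *«implied by the invariance with respect to G-valued transformations, and by the analyticity of
the function»* ([I] p. 283) / *«by the analyticity»* ([II] p. 21) for the semisimple `G = SU(N)`. [folklore] -/
theorem eqOn_subTube_of_eqOn_specialUnitary {a : ℝ} {φ ψ : (ι → M[N]) → ℂ}
    (hφ : DifferentiableOn ℂ φ (TubeCfg ι (M[N]) a)) (hψ : DifferentiableOn ℂ ψ (TubeCfg ι (M[N]) a))
    (h : ∀ V : ι → M[N], (∀ b, V b ∈ Matrix.specialUnitaryGroup (Fin N) ℂ) → φ V = ψ V) :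
    EqOn φ ψ (SubTube ι N a) := by
  intro V hV
  choose B U hB hsa htr hU hVeq using fun b => exists_polar_of_mem_subTube hV b
  have hUu : ∀ b, U b ∈ unitary (M[N]) := fun b => (Matrix.mem_specialUnitaryGroup_iff.1 (hU b)).1
  have hf : AnalyticOnNhd ℂ (φ ∘ sliceCurve B U) (sliceRegion B a) :=
    (hφ.comp (differentiable_sliceCurve B U).differentiableOn (mapsTo_sliceCurve B hUu a)).analyticOnNhd
      (isOpen_sliceRegion B a)
  have hg : AnalyticOnNhd ℂ (ψ ∘ sliceCurve B U) (sliceRegion B a) :=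
    (hψ.comp (differentiable_sliceCurve B U).differentiableOn (mapsTo_sliceCurve B hUu a)).analyticOnNhd
      (isOpen_sliceRegion B a)
  -- at real `t` the slice curve through the POLAR data is `SU(N)`-valued: unitary, and `det = e^{−it·tr B_b}·det U_b = 1`
  have hSU : ∀ (t : ℝ) (b : ι), sliceCurve B U (t : ℂ) b ∈ Matrix.specialUnitaryGroup (Fin N) ℂ := by
    intro t b
    refine Matrix.mem_specialUnitaryGroup_iff.2 ⟨sliceCurve_ofReal_mem_unitary B hUu t b, ?_⟩
    show (exp (sliceGen (B b) (t : ℂ)) * U b).det = 1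
    rw [Matrix.det_mul, sliceGen_of_isSelfAdjoint (hsa b), det_exp_smul_of_trace_eq_zero (htr b),
      (Matrix.mem_specialUnitaryGroup_iff.1 (hU b)).2, one_mul]
  have hreal : ∀ t : ℝ, (φ ∘ sliceCurve B U) (t : ℂ) = (ψ ∘ sliceCurve B U) (t : ℂ) := fun t =>
    h _ (hSU t)
  have hEq : EqOn (φ ∘ sliceCurve B U) (ψ ∘ sliceCurve B U) (sliceRegion B a) :=
    hf.eqOn_of_preconnected_of_frequently_eq hg (convex_sliceRegion B a).isPreconnected
      (zero_mem_sliceRegion hB) (frequently_nhdsNE_zero_of_forall_ofReal hreal)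
  have hV₀ : sliceCurve B U Complex.I = V := by
    rw [sliceCurve_I]
    exact funext fun b => (hVeq b).symm
  have hI := hEq (I_mem_sliceRegion hB)
  simp only [Function.comp_apply, hV₀] at hI
  exact hI

/-- In particular a function holomorphic on the `a`-tube and CONSTANT on the `SU(N)`-valued configurations is that
constant on the `Gᶜ`-valued tube. [folklore] -/
theorem eq_const_on_subTube_of_specialUnitary {a : ℝ} {φ : (ι → M[N]) → ℂ} {c : ℂ}
    (hφ : DifferentiableOn ℂ φ (TubeCfg ι (M[N]) a))
    (h : ∀ V : ι → M[N], (∀ b, V b ∈ Matrix.specialUnitaryGroup (Fin N) ℂ) → φ V = c) :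
    ∀ V ∈ SubTube ι N a, φ V = c :=
  eqOn_subTube_of_eqOn_specialUnitary hφ (differentiableOn_const c) h

end Identity

/-! ## §5. THE PARAGRAPH FOR `G = SU(N)`: (26) for `SU(N)`-valued site-dependent transformations + holomorphy on the
## tube ⇒ constancy on (`SL(N, ℂ)`-orbit) ∩ (`Gᶜ`-valued tube), and the extension to whole `SL(N, ℂ)`-orbits -/

section Paragraph

/-- `M_N(ℂ)`. -/
local notation "M[" N "]" => Matrix (Fin N) (Fin N) ℂ

attribute [local instance] B10Eq29TubeLine.cstarAlgebraMatrix

variable {ι S : Type*} {N : ℕ} (γ : Ends ι S)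

/-- **(26) FOR THE SEMISIMPLE GROUP `G = SU(N)`** — *«gauge invariant with respect to all G-valued transformations»*
([II] p. 21; [I] (3.29) p. 276; B10 (26) p. 263 *«for all gauge transformations 𝓊»*): `F(𝐕ᵘ) = F(𝐕)` for all
`SU(N)`-valued site-dependent `u` and all `SU(N)`-valued configurations `𝐕` (`𝐕ᵘ_b = u(b₋)·V_b·u(b₊)⁻¹`,
`B13Inv214Orbit.gaugeAct`).  The `U(N)`-form is `B10Eq26SiteGauge.SiteGaugeInv` (which implies this one,
`siteGaugeInvSU_of_siteGaugeInv`, and is NOT implied by it, §6 (T1)).  A HYPOTHESIS about print's expressions, never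
discharged here. [cite: Balaban1988RG2Cluster, p.21; Balaban1987RG1, (3.29) p.276, pp.251–252; Balaban1985UV3, (26) p.263] -/
def SiteGaugeInvSU (F : (ι → M[N]) → ℂ) : Prop :=
  ∀ u : S → M[N], (∀ x, u x ∈ Matrix.specialUnitaryGroup (Fin N) ℂ) →
    ∀ V : ι → M[N], (∀ b, V b ∈ Matrix.specialUnitaryGroup (Fin N) ℂ) → F (gaugeAct γ u V) = F V

/-- The `U(N)`-form (26) of `B10Eq26SiteGauge` implies the `SU(N)`-form. [folklore] -/
theorem siteGaugeInvSU_of_siteGaugeInv {F : (ι → M[N]) → ℂ} (h : SiteGaugeInv γ F) : SiteGaugeInvSU γ F :=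
  fun u hu V hV => h u (fun x => (Matrix.mem_specialUnitaryGroup_iff.1 (hu x)).1) V
    fun b => (Matrix.mem_specialUnitaryGroup_iff.1 (hV b)).1

variable [Fintype ι]

/-- **CONTINUATION IN THE CONFIGURATION** (`SU(N)`-valued `u` fixed): (26)\_{SU} + holomorphy on the `a`-tube ⇒
`F(𝐕ᵘ) = F(𝐕)` on the whole `Gᶜ`-valued tube `SubTube ι N a` (§4 applied to `F ∘ (·)ᵘ` and `F`; `SU(N)`-valued `u`
preserve the tube with its half-width, `B10Eq26SiteGauge.gaugeAct_mem_tubeCfg_of_unitary`).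
[cite: Balaban1988RG2Cluster, p.21; Balaban1987RG1, p.283] -/
theorem siteGaugeInvSU_subTube {a : ℝ} {F : (ι → M[N]) → ℂ} (hF : DifferentiableOn ℂ F (TubeCfg ι (M[N]) a))
    (h26 : SiteGaugeInvSU γ F) {u : S → M[N]} (hu : ∀ x, u x ∈ Matrix.specialUnitaryGroup (Fin N) ℂ) :
    ∀ V ∈ SubTube ι N a, F (gaugeAct γ u V) = F V := by
  have hu' : ∀ x, u x ∈ unitary (M[N]) := fun x => (Matrix.mem_specialUnitaryGroup_iff.1 (hu x)).1
  exact eqOn_subTube_of_eqOn_specialUnitary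
    (hF.comp (differentiable_gaugeAct_cfg γ u).differentiableOn fun _ hV => gaugeAct_mem_tubeCfg_of_unitary γ hu' hV)
    hF fun V hV => h26 u hu V hV

variable [Fintype S]

/-- **CONTINUATION IN THE TRANSFORMATION** — *«the invariance can be extended, by the analyticity, to Gᶜ-valued gauge
transformations in a small neighborhood of the space of G-valued ones»* ([II] p. 21), `G = SU(N)`: with margins
`MapsTube` (b10's binder; explicit thirds in `B13Inv214PolarChain.mapsTube_third`), (26)\_{SU} + holomorphy on the
`a`-tube give `F(𝐕ᵘ) = F(𝐕)` for every `SL(N, ℂ)`-VALUED `u` of the `c`-tube and every `𝐕` of the `Gᶜ`-valued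
`a₀`-tube (§4 in the variable `u`, sites as indices: `u ↦ F(𝐕ᵘ)` is holomorphic on the `c`-tube,
`B13Inv214Orbit.differentiableOn_gaugeAct`, and constant `= F(𝐕)` on the `SU(N)`-valued `u` by `siteGaugeInvSU_subTube`).
[cite: Balaban1988RG2Cluster, p.21; Balaban1987RG1, p.276 (after (3.29)), p.283] -/
theorem slInvariant_subTube {a a₀ c : ℝ} (hc : 0 < c) (hmaps : MapsTube (M[N]) γ a a₀ c) {F : (ι → M[N]) → ℂ}
    (hF : DifferentiableOn ℂ F (TubeCfg ι (M[N]) a)) (h26 : SiteGaugeInvSU γ F) :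
    ∀ u ∈ SubTube S N c, ∀ V ∈ SubTube ι N a₀, F (gaugeAct γ u V) = F V := by
  intro u hu V hV
  have hΦ : DifferentiableOn ℂ (fun u' : S → M[N] => F (gaugeAct γ u' V)) (TubeCfg S (M[N]) c) :=
    hF.comp (differentiableOn_gaugeAct γ V c) fun u' hu' => hmaps u' hu' V hV.1
  have hVa : V ∈ SubTube ι N a := ⟨tubeCfg_subset_of_mapsTube γ hc hmaps hV.1, hV.2⟩
  exact eq_const_on_subTube_of_specialUnitary hΦ (fun u' hu' => siteGaugeInvSU_subTube γ hF h26 hu' V hVa) u hu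

/-- (R2) for `G = SU(N)`: near-orbit constancy on the `Gᶜ`-valued `a₀`-tube for `SL(N, ℂ)`-valued tube-valued steps.
[cite: Balaban1988RG2Cluster, pp.21–22] -/
theorem nearOrbitConstOnIn_subTube {a a₀ c : ℝ} (hc : 0 < c) (hmaps : MapsTube (M[N]) γ a a₀ c)
    {F : (ι → M[N]) → ℂ} (hF : DifferentiableOn ℂ F (TubeCfg ι (M[N]) a)) (h26 : SiteGaugeInvSU γ F) :
    NearOrbitConstOnIn γ (slUnits N) c F (SubTube ι N a₀) := by
  intro h V hh htube hV _
  rw [smul_eq_gaugeAct]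
  exact slInvariant_subTube γ hc hmaps hF h26 _ ⟨htube, fun x => mem_slUnits_iff.1 (hh x)⟩ V hV

/-- **(R3) FOR `G = SU(N)`, END TO END** — *«This means that the expressions are constant on intersections of orbits
with the corresponding space of configurations»* ([II] p. 22): margins (`c > 0`), holomorphy on the `a`-tube and (26)
for the `SU(N)`-valued site-dependent transformations give constancy of `F` on (`SL(N, ℂ)`-orbit) ∩ (`Gᶜ`-valued
`a₀`-tube) — the near-orbit constancy joined with the `SL`-relative polar chain of §3.
[cite: Balaban1988RG2Cluster, p.22; Balaban1987RG1, pp.251–252, p.283] -/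
theorem orbitConstOnIn_subTube {a a₀ c : ℝ} (hc : 0 < c) (hmaps : MapsTube (M[N]) γ a a₀ c)
    {F : (ι → M[N]) → ℂ} (hF : DifferentiableOn ℂ F (TubeCfg ι (M[N]) a)) (h26 : SiteGaugeInvSU γ F) :
    OrbitConstOnIn γ (slUnits N) F (SubTube ι N a₀) :=
  orbitConstOnIn_of_nearOrbitConstOnIn γ _ (nearOrbitConstOnIn_subTube γ hc hmaps hF h26)
    (tubeChainConnectedIn_subTube γ hc a₀)

/-- **THE BINDER-MINIMAL FORM**: holomorphy on the `a`-tube (`a > 0`) and (26)\_{SU} ALONE give constancy on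
(`SL(N, ℂ)`-orbit) ∩ (`Gᶜ`-valued `a/3`-tube). [cite: Balaban1988RG2Cluster, p.22; Balaban1987RG1, p.283] -/
theorem orbitConstOnIn_subTube_third {a : ℝ} (ha : 0 < a) {F : (ι → M[N]) → ℂ}
    (hF : DifferentiableOn ℂ F (TubeCfg ι (M[N]) a)) (h26 : SiteGaugeInvSU γ F) :
    OrbitConstOnIn γ (slUnits N) F (SubTube ι N (a / 3)) :=
  orbitConstOnIn_subTube γ (by positivity) (mapsTube_third γ ha) hF h26

/-- The same, unfolded: `F(g • 𝐕) = F(𝐕)` for every `SL(N, ℂ)`-valued `g` (no smallness) and every `𝐕` with `𝐕` and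
`g • 𝐕` in the `Gᶜ`-valued `a/3`-tube. [cite: Balaban1988RG2Cluster, p.22] -/
theorem apply_smul_eq_of_det_eq_one {a : ℝ} (ha : 0 < a) {F : (ι → M[N]) → ℂ}
    (hF : DifferentiableOn ℂ F (TubeCfg ι (M[N]) a)) (h26 : SiteGaugeInvSU γ F) (g : S → (M[N])ˣ)
    (hg : ∀ x, Matrix.det (g x : M[N]) = 1) (V : Cfg γ (M[N])) (hV : V ∈ SubTube ι N (a / 3))
    (hgV : g • V ∈ SubTube ι N (a / 3)) : F (g • V) = F V :=
  orbitConstOnIn_subTube_third γ ha hF h26 g V hg hV hgV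

/-- **(R4) FOR `G = SU(N)`** — *«We extend them to constant functions on whole orbits having non-empty intersections
with the space»* ([II] p. 22): under the same two hypotheses `F` extends from the `Gᶜ`-valued `a/3`-tube to a function
of all configurations invariant under every `SL(N, ℂ)`-valued gauge transformation. [cite: Balaban1988RG2Cluster, p.22] -/
theorem exists_slOrbitExtension_subTube_third {a : ℝ} (ha : 0 < a) {F : (ι → M[N]) → ℂ}
    (hF : DifferentiableOn ℂ F (TubeCfg ι (M[N]) a)) (h26 : SiteGaugeInvSU γ F) :
    ∃ Fext : Cfg γ (M[N]) → ℂ, (∀ (g : S → (M[N])ˣ) (V : Cfg γ (M[N])), (∀ x, g x ∈ slUnits N) →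
      Fext (g • V) = Fext V) ∧ ∀ V ∈ SubTube ι N (a / 3), Fext V = F V :=
  (orbitConstOnIn_iff_extends γ _ F _).1 (orbitConstOnIn_subTube_third γ ha hF h26)

/-- COMPARISON WITH THE `U(𝔸)`-MODEL: under b10's STRONGER `U(N)`-form (26) the conclusion of
`B13Inv214PolarChain.orbitConstOn_tube_third` (all of `GL`, the whole `a/3`-tube) implies the present one. [folklore] -/
theorem orbitConstOnIn_subTube_third_of_siteGaugeInv {a : ℝ} (ha : 0 < a) {F : (ι → M[N]) → ℂ}
    (hF : DifferentiableOn ℂ F (TubeCfg ι (M[N]) a)) (h26 : SiteGaugeInv γ F) :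
    OrbitConstOnIn γ (slUnits N) F (SubTube ι N (a / 3)) :=
  (orbitConstOnIn_of_orbitConstOn γ ⊤ (B13Inv214PolarChain.orbitConstOn_tube_third γ ha hF h26)).anti le_top
    (subTube_subset_tubeCfg _)

end Paragraph


/-! ## §6. Non-vacuity and sharpness (`N = 2`; one bond `()` from site `true` to site `false`,
## `B13Inv214Orbit.toyEnds`) -/

section Toys

/-- `M_N(ℂ)`. -/
local notation "M[" N "]" => Matrix (Fin N) (Fin N) ℂ

attribute [local instance] B10Eq29TubeLine.cstarAlgebraMatrix

open B13Inv214Orbit (toyEnds)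

variable {N : ℕ}

/-- Matrix entries are ℂ-linear, hence holomorphic. [folklore] -/
theorem differentiable_entry (i j : Fin N) : Differentiable ℂ (fun A : M[N] => A i j) :=
  (LinearMap.toContinuousLinearMap (Matrix.entryLinearMap ℂ ℂ i j)).differentiable

/-- The determinant is holomorphic on `M_N(ℂ)` (Leibniz expansion). [folklore] -/
theorem differentiable_det : Differentiable ℂ (fun A : M[N] => A.det) := by
  have hentry : ∀ i j : Fin N, ContDiff ℂ ⊤ (fun A : M[N] => A i j) := fun i j =>
    (LinearMap.toContinuousLinearMap (Matrix.entryLinearMap ℂ ℂ i j)).contDiff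
  have h : ContDiff ℂ ⊤ (fun A : M[N] => A.det) := by
    simp only [Matrix.det_apply']
    exact ContDiff.sum fun σ _ => contDiff_const.mul (contDiff_prod fun i _ => hentry _ _)
  exact h.differentiable (by simp)

/-- **THE BOND DETERMINANT `F(𝐕) = det V_{b₀}` SATISFIES (26) FOR `G = SU(N)`** (any bond system, any `N`):
`det(u(b₋)·V_b·u(b₊)⋆) = det V_b` for `SU(N)`-valued `u`. [folklore] -/
theorem siteGaugeInvSU_det {ι S : Type*} (γ : Ends ι S) (b₀ : ι) :
    SiteGaugeInvSU γ (fun V : ι → M[N] => (V b₀).det) := by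
  intro u hu V _
  have hu' : ∀ x, u x ∈ unitary (M[N]) := fun x => (Matrix.mem_specialUnitaryGroup_iff.1 (hu x)).1
  show (gaugeAct γ u V b₀).det = (V b₀).det
  rw [gaugeAct_eq_star γ hu']
  show (u (γ.src b₀) * V b₀ * star (u (γ.tgt b₀))).det = (V b₀).det
  rw [Matrix.det_mul, Matrix.det_mul, Matrix.star_eq_conjTranspose, Matrix.det_conjTranspose,
    (Matrix.mem_specialUnitaryGroup_iff.1 (hu _)).2, (Matrix.mem_specialUnitaryGroup_iff.1 (hu _)).2, star_one,
    one_mul, mul_one]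

/-- The bond determinant is holomorphic on every tube (indeed everywhere). [folklore] -/
theorem differentiableOn_toyDet (a : ℝ) :
    DifferentiableOn ℂ (fun V : Unit → M[2] => (V ()).det) (TubeCfg Unit (M[2]) a) :=
  (differentiable_det.comp (differentiable_apply ())).differentiableOn

/-- The scalar matrix `i·1 ∈ U(2)`, with `det(i·1) = −1`. [folklore] -/
theorem I_smul_one_mem_unitary : (Complex.I • (1 : M[2])) ∈ unitary (M[2]) ∧
    (Complex.I • (1 : M[2])).det = -1 := by
  refine ⟨Unitary.mem_iff.2 ⟨?_, ?_⟩, ?_⟩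
  · rw [star_smul, star_one, Complex.star_def, Complex.conj_I, smul_mul_assoc, one_mul, smul_smul, neg_mul,
      Complex.I_mul_I, neg_neg, one_smul]
  · rw [star_smul, star_one, Complex.star_def, Complex.conj_I, mul_smul_comm, mul_one, smul_smul, neg_mul,
      Complex.I_mul_I, neg_neg, one_smul]
  · rw [Matrix.det_smul, Matrix.det_one, Fintype.card_fin, mul_one, Complex.I_sq]

/-- **(T1) THE `U(N)`-FORM (26) OF `B10Eq26SiteGauge` FAILS FOR THE BOND DETERMINANT** (`u(true) = i·1 ∈ U(2) ∖ SU(2)`,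
`u(false) = 1`, `𝐕 ≡ 1`: `det(i·1) = −1 ≠ 1`) — so §5's hypothesis `SiteGaugeInvSU` is STRICTLY WEAKER than the
`U(𝔸)`-model's, and `B13Inv214PolarChain.orbitConstOn_tube_third` does not apply to it. [folklore] -/
theorem not_siteGaugeInv_toyDet : ¬ SiteGaugeInv toyEnds (fun V : Unit → M[2] => (V ()).det) := by
  intro h
  set W : M[2] := Complex.I • (1 : M[2]) with hW
  let u : Bool → M[2] := fun x => bif x then W else 1
  have hu : ∀ x, u x ∈ unitary (M[2]) := by
    intro x; cases x
    · exact one_mem _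
    · exact I_smul_one_mem_unitary.1
  have h1 := h u hu (fun _ => 1) fun _ => one_mem _
  change (W * 1 * Ring.inverse (1 : M[2])).det = (1 : M[2]).det at h1
  rw [Ring.inverse_one, mul_one, mul_one, Matrix.det_one, hW, I_smul_one_mem_unitary.2] at h1
  norm_num at h1

/-- **(T1, continued) AND THE `GL`-ORBIT CONCLUSION OF `B13Inv214PolarChain.orbitConstOn_tube_third` FAILS FOR IT**:
`g(true) = e^{s}·1` (`0 < s < a/3`, NOT in `SL(2, ℂ)`), `g(false) = 1` moves `𝐕 ≡ 1` inside the `a/3`-tube and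
multiplies `det V_b` by `e^{2s} ≠ 1`.  So for `G = SU(N)` the orbit paragraph holds for `Gᶜ = SL(N, ℂ)`-orbits
(§5) and NOT for `GL(N, ℂ)`-orbits. [folklore] -/
theorem not_orbitConstOn_toyDet {a : ℝ} (ha : 0 < a) :
    ¬ OrbitConstOn toyEnds (fun V : Unit → M[2] => (V ()).det) (TubeCfg Unit (M[2]) (a / 3)) := by
  intro h
  set s : ℝ := a / 6 with hs
  have hs0 : 0 < s := by positivity
  have hsa : |s| * ‖(1 : M[2])‖ < a / 3 := by rw [abs_of_pos hs0, norm_one, mul_one, hs]; linarith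
  let g : Bool → (M[2])ˣ := fun x => bif x then expUnit ((s : ℂ) • (1 : M[2])) else 1
  let V : Cfg toyEnds (M[2]) := fun _ => 1
  have hV : V ∈ TubeCfg Unit (M[2]) (a / 3) := mem_tubeCfg_of_unitary (by positivity) fun _ => one_mem _
  have hgV_eq : g • V = fun _ => exp ((s : ℂ) • (1 : M[2])) * 1 := by
    funext b
    rw [B13Inv214PolarChain.smul_apply]
    change (expUnit ((s : ℂ) • (1 : M[2])) : M[2]) * 1 * (((1 : (M[2])ˣ)⁻¹ : (M[2])ˣ) : M[2]) = _
    rw [inv_one, Units.val_one, mul_one, val_expUnit]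
  have hgV : g • V ∈ TubeCfg Unit (M[2]) (a / 3) := by
    rw [hgV_eq]
    refine mem_tubeCfg.2 fun _ => exp_mul_mem_tube ?_ (one_mem _)
    rwa [norm_smul, Complex.norm_real, Real.norm_eq_abs]
  have h1 := h g V hV hgV
  change ((g • V) ()).det = (1 : M[2]).det at h1
  rw [hgV_eq, mul_one, det_exp, Matrix.trace_smul, Matrix.trace_one, Fintype.card_fin, Matrix.det_one,
    smul_eq_mul] at h1
  have h2 := congrArg norm h1
  rw [show ((s : ℂ) * (2 : ℕ) : ℂ) = ((s * 2 : ℝ) : ℂ) by push_cast; ring, Complex.norm_exp_ofReal, norm_one,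
    Real.exp_eq_one_iff] at h2
  linarith

/-- (T1, concluded) … WHILE §5 APPLIES: the bond determinant is constant on (`SL(2, ℂ)`-orbit) ∩ (`Gᶜ`-valued
`a/3`-tube) (of course: it is `≡ 1` there — the content is that the HYPOTHESES of §5 hold where those of the `U(𝔸)`-model
fail). [folklore] -/
theorem orbitConstOnIn_toyDet {a : ℝ} (ha : 0 < a) :
    OrbitConstOnIn toyEnds (slUnits 2) (fun V : Unit → M[2] => (V ()).det) (SubTube Unit 2 (a / 3)) :=
  orbitConstOnIn_subTube_third toyEnds ha (differentiableOn_toyDet a) (siteGaugeInvSU_det toyEnds ())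

/-- The rotation `J = [[0, 1], [−1, 0]] ∈ SU(2)`. [folklore] -/
def rotJ : M[2] := !![0, 1; -1, 0]

/-- `J ∈ SU(2)`. [folklore] -/
theorem rotJ_mem_specialUnitaryGroup : rotJ ∈ Matrix.specialUnitaryGroup (Fin 2) ℂ := by
  refine Matrix.mem_specialUnitaryGroup_iff.2 ⟨?_, ?_⟩
  · rw [Matrix.mem_unitaryGroup_iff]
    ext i j
    fin_cases i <;> fin_cases j <;>
      simp [rotJ, Matrix.mul_apply, Fin.sum_univ_two, Matrix.star_apply]
  · simp [rotJ, Matrix.det_fin_two_of]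

/-- `J` as a unit of `M₂(ℂ)` (inverse `J⋆`). [folklore] -/
noncomputable def rotJU : (M[2])ˣ :=
  ⟨rotJ, star rotJ, Unitary.mul_star_self_of_mem (Matrix.mem_specialUnitaryGroup_iff.1 rotJ_mem_specialUnitaryGroup).1,
    Unitary.star_mul_self_of_mem (Matrix.mem_specialUnitaryGroup_iff.1 rotJ_mem_specialUnitaryGroup).1⟩

/-- **(T2) THE CONCLUSION SET MUST BE THE `Gᶜ`-VALUED TUBE, NOT THE WHOLE TUBE.**  `F(𝐕) = (det V_b − 1)·(V_b)₀₀` is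
holomorphic and satisfies (26)\_{SU} (both sides vanish on `SU(2)`-valued configurations), yet is NOT constant on
(`SL(2, ℂ)`-orbit) ∩ (`a/3`-TUBE): at the `U(2)`-valued `𝐕 ≡ i·1` (in the tube, `det = −1`) the `SU(2)`-valued
`g(true) = J`, `g(false) = 1` gives `F(g • 𝐕) = (−2)·(iJ)₀₀ = 0 ≠ −2i = F(𝐕)`.  So `SubTube` in
`orbitConstOnIn_subTube_third` cannot be replaced by `TubeCfg` — for `G = SU(N)` the «corresponding space of
configurations» is `Gᶜ`-valued ([I] p. 252, (1.13) (ii)). [folklore] -/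
theorem example_conclusion_needs_subTube {a : ℝ} (ha : 0 < a) :
    let F : (Unit → M[2]) → ℂ := fun V => ((V ()).det - 1) * (V ()) 0 0
    DifferentiableOn ℂ F (TubeCfg Unit (M[2]) a) ∧ SiteGaugeInvSU toyEnds F ∧
      ¬ OrbitConstOnIn toyEnds (slUnits 2) F (TubeCfg Unit (M[2]) (a / 3)) := by
  intro F
  refine ⟨?_, ?_, ?_⟩
  · exact (((differentiable_det.comp (differentiable_apply ())).sub_const 1).mul
      ((differentiable_entry 0 0).comp (differentiable_apply ()))).differentiableOn
  · intro u hu V hV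
    have hdet : (gaugeAct toyEnds u V ()).det = (V ()).det := siteGaugeInvSU_det toyEnds () u hu V hV
    show ((gaugeAct toyEnds u V ()).det - 1) * _ = ((V ()).det - 1) * _
    rw [hdet, (Matrix.mem_specialUnitaryGroup_iff.1 (hV ())).2, sub_self, zero_mul, zero_mul]
  · intro h
    set D : M[2] := Complex.I • (1 : M[2]) with hD
    let g : Bool → (M[2])ˣ := fun x => bif x then rotJU else 1
    have hg : ∀ x, g x ∈ slUnits 2 := by
      intro x; cases x
      · exact (slUnits 2).one_mem
      · exact (Matrix.mem_specialUnitaryGroup_iff.1 rotJ_mem_specialUnitaryGroup).2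
    let V : Cfg toyEnds (M[2]) := fun _ => D
    have hV : V ∈ TubeCfg Unit (M[2]) (a / 3) :=
      mem_tubeCfg_of_unitary (by positivity) fun _ => I_smul_one_mem_unitary.1
    have hgV_eq : g • V = fun _ => rotJ * D := by
      funext b
      rw [B13Inv214PolarChain.smul_apply]
      change (rotJU : M[2]) * D * (((1 : (M[2])ˣ)⁻¹ : (M[2])ˣ) : M[2]) = _
      rw [inv_one, Units.val_one, mul_one]
      rfl
    have hgV : g • V ∈ TubeCfg Unit (M[2]) (a / 3) := by
      rw [hgV_eq]
      exact mem_tubeCfg_of_unitary (by positivity) fun _ =>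
        mul_mem (Matrix.mem_specialUnitaryGroup_iff.1 rotJ_mem_specialUnitaryGroup).1 I_smul_one_mem_unitary.1
    have h1 := h g V hg hV hgV
    change (((g • V) ()).det - 1) * (g • V) () 0 0 = (D.det - 1) * D 0 0 at h1
    rw [hgV_eq] at h1
    change ((rotJ * D).det - 1) * (rotJ * D) 0 0 = (D.det - 1) * D 0 0 at h1
    have hJD : (rotJ * D) 0 0 = 0 := by
      rw [hD, mul_smul_comm, mul_one, Matrix.smul_apply, smul_eq_mul]
      simp [rotJ]
    have hD00 : D 0 0 = Complex.I := by
      rw [hD, Matrix.smul_apply, Matrix.one_apply_eq, smul_eq_mul, mul_one]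
    rw [hJD, mul_zero, hD00, hD, I_smul_one_mem_unitary.2] at h1
    have h2 : (0 : ℂ) = -2 * Complex.I := by rw [h1]; ring
    have h3 := congrArg Complex.im h2
    simp at h3

/-- A traceless self-adjoint direction: `H = diag(1, −1) ∈ i·𝔰𝔲(2)`. [folklore] -/
def diagH : M[2] := !![1, 0; 0, -1]

/-- `H` is self-adjoint, traceless and nonzero. [folklore] -/
theorem diagH_props : IsSelfAdjoint diagH ∧ diagH.trace = 0 ∧ diagH ≠ 0 := by
  refine ⟨?_, ?_, ?_⟩
  · show star diagH = diagH
    ext i j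
    fin_cases i <;> fin_cases j <;> simp [diagH, Matrix.star_apply]
  · simp [diagH, Matrix.trace_fin_two_of]
  · intro h
    have := congrFun (congrFun h 0) 0
    simp [diagH] at this

/-- **(T0) THE `Gᶜ`-VALUED TUBE IS STRICTLY BETWEEN THE `SU(2)`-VALUED CONFIGURATIONS AND THE TUBE**: `e^{sH}`
(`0 < s`, `s‖H‖ < a`) is in `SubTube Unit 2 a` and NOT unitary (a unitary `e^{sH}·1·e^{−0}` equals `1` by the polar
rigidity `B13Inv214PolarChain.exp_mul_mul_exp_neg_eq_of_mem_unitary`, so `sH = log e^{sH} = log 1 = 0`); and `i·1` is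
in the tube and not in the sub-tube (`det = −1`).  So §4/§5 are neither about `SU(2)`-valued configurations only nor
about the whole tube. [folklore] -/
theorem example_subTube_strict {a : ℝ} (ha : 0 < a) :
    (∃ V ∈ SubTube Unit 2 a, V () ∉ unitary (M[2])) ∧
      ∃ V ∈ TubeCfg Unit (M[2]) a, V ∉ SubTube Unit 2 a := by
  obtain ⟨hsa, htr, hne⟩ := diagH_props
  refine ⟨?_, ⟨fun _ => Complex.I • (1 : M[2]), mem_tubeCfg_of_unitary ha fun _ => I_smul_one_mem_unitary.1,
    fun hV => by have := hV.2 (); rw [I_smul_one_mem_unitary.2] at this; norm_num at this⟩⟩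
  set s : ℝ := a / (2 * (‖diagH‖ + 1)) with hs
  have hs0 : 0 < s := by positivity
  have hsH : ‖(s : ℂ) • diagH‖ < a := by
    rw [norm_smul, Complex.norm_real, Real.norm_eq_abs, abs_of_pos hs0, hs]
    have h1 : a / (2 * (‖diagH‖ + 1)) * ‖diagH‖ ≤ a / (2 * (‖diagH‖ + 1)) * (‖diagH‖ + 1) :=
      mul_le_mul_of_nonneg_left (le_add_of_nonneg_right zero_le_one) (by positivity)
    have h2 : a / (2 * (‖diagH‖ + 1)) * (‖diagH‖ + 1) = a / 2 := by
      field_simp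
    linarith
  have hsa' : IsSelfAdjoint ((s : ℂ) • diagH) := (show IsSelfAdjoint (s : ℂ) from Complex.conj_ofReal s).smul hsa
  refine ⟨fun _ => exp ((s : ℂ) • diagH), ?_, ?_⟩
  · refine mem_subTube_iff.2 fun _ => ⟨(s : ℂ) • diagH, 1, hsH, ?_, Submonoid.one_mem _, by rw [mul_one]⟩
    rw [Matrix.trace_smul, htr, smul_zero]
  · intro hU
    have hrig := B13Inv214PolarChain.exp_mul_mul_exp_neg_eq_of_mem_unitary hsa' (IsSelfAdjoint.zero _)
      (one_mem (unitary (M[2]))) (by rwa [neg_zero, exp_zero, mul_one, mul_one])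
    rw [neg_zero, exp_zero, mul_one, mul_one] at hrig
    have hlog := congrArg CFC.log hrig
    rw [CFC.log_exp _ hsa', CFC.log_one] at hlog
    exact hne ((smul_eq_zero.1 hlog).resolve_left (by exact_mod_cast hs0.ne'))

end Toys

end Literature.MathematicalPhysics.QuantumFieldTheory.Balaban1983to89.B13Inv214OrbitSUN
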